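import Summits.AtomisticToContinuum.HydrodynamicLimit.Theorems.CollisionIsometryCLTAdaptedWeightCLTTimeLocal

/-!
# `stub_reduction` of the line `contact-source-duhamel`, helper file 1/6: the dictionary
(crux `CollisionIsometryCLT.AdaptedWeightCLT`, stmt-AtomisticToContinuum-14868 = the rev-12 TIME-LOCAL form of
the crux; `--supports`)

-- adapted from Theorems/CollisionIsometryCLTAdaptedWeightCLTStubReductionDictionary.lean

RE-HOME under the namespace `…ContactSourceDuhamel.TimeLocal.Reduction` of the dictionary file accepted for the
rev-11 item (tree file `Theorems/CollisionIsometryCLTAdaptedWeightCLTStubReductionDictionary.lean`, namespace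
`…ContactSourceDuhamel.Reduction`). That file imports the rev-11 statements module
`Theorems/CollisionIsometryCLTAdaptedWeightCLTStatements.lean`, which no longer elaborates since the route
restatement of rev 12 (`lean check` rc 1: type mismatch `Iff.rfl` at `adaptedWeightCLT_iff`) and cannot be
amended append-only by a prover; hence neither module is importable for the rev-12 item. The only statement
used here, `DuhamelIdentity`, has a byte-identical body in `TimeLocal` (module `…AdaptedWeightCLTTimeLocal`); all
objects (`blkFlow`, `pastF`, …) are the unchanged ones of `…AdaptedWeightCLTLine`. The text below is the accepted
text verbatim against the new namespace.

Steps (a)–(c) of the reduction, as standalone identities/inequalities (no measure theory):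
* (a) FINITE-SUM DICTIONARY: integrals against the empirical measure are `(N+1)⁻¹`-weighted finite
  sums, `⟨C2 j k, y⊗y⟩ = y_j y_k − δ_{jk}|y|²/3`, `⟨C3 a, y^{⊗3}⟩ = ½|y|² y_a`, hence the crux's
  `D N s z x j k = blkFlow 2 … (C2 j k)`, `(q N s z x) a = blkFlow 3 … (C3 a)` and the crux integrand
  `Σ D² + |q|²` IS `DefectSq` (`cruxIntegrand_eq`, every `s z x`);
* (b) on the flow-dictionary event `blkFlow = blkF` of the fold restarted at the window start, and the
  Duhamel identity paired with the weights gives `blkF = pastF + xiF`;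
* (c) pointwise Peter–Paul: `DefectSq ≤ 2η DefectSq + (4η)⁻¹ (PastSq + XiDevSq) + XiCorr` (`defectSq_le`).
Registered anchor: `reduction_winLen_nonneg`.
-/

namespace Summit.AtomisticToContinuum.HydrodynamicLimit.Theorems.ContactSourceDuhamel.TimeLocal.Reduction

open scoped BigOperators Topology Classical MeasureTheory ENNReal InnerProductSpace
open Filter Set MeasureTheory
open Literature.Analysis.FluidPDE
open Literature.MathematicalPhysics.KineticTheory (hsDiameter hsDiameter_le empiricalDensityField
  empiricalMomentumField)

noncomputable section


variable {σ : ℝ} {N : ℕ}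

/-- Integration of a vector-valued observable against the empirical measure of `N + 1` particles is
the normalised finite sum `(N+1)⁻¹ • ∑ᵢ F(zᵢ)`. -/
theorem integral_empiricalMeasure_vec {E : Type*} [NormedAddCommGroup E] [NormedSpace ℝ E]
    [CompleteSpace E] (z : Cfg N) (F : T3 × V3 → E) :
    ∫ y, F y ∂empiricalMeasure z = (((N + 1 : ℕ) : ℝ))⁻¹ • ∑ i, F (z i) := by
  rw [empiricalMeasure_eq, integral_smul_measure,
    integral_finsetSum_measure fun i _ => integrable_dirac (by simp)]
  simp only [integral_dirac, ENNReal.toReal_inv, ENNReal.toReal_natCast]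

/-- Real-valued case of `integral_empiricalMeasure_vec` (with `*` instead of `•`). -/
theorem integral_empiricalMeasure_real (z : Cfg N) (F : T3 × V3 → ℝ) :
    ∫ y, F y ∂empiricalMeasure z = (((N + 1 : ℕ) : ℝ))⁻¹ * ∑ i, F (z i) :=
  integral_empiricalMeasure z F

/-- Sums over rank-2 multi-indices are double sums. -/
theorem sum_tens_two (g : (Fin 2 → Fin 3) → ℝ) :
    ∑ idx : Fin 2 → Fin 3, g idx = ∑ a : Fin 3, ∑ b : Fin 3, g ![a, b] := by
  rw [← (Fin.consEquiv fun _ : Fin 2 => Fin 3).sum_comp, Fintype.sum_prod_type]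
  refine Finset.sum_congr rfl fun a _ => ?_
  rw [← (Fin.consEquiv fun _ : Fin 1 => Fin 3).sum_comp, Fintype.sum_prod_type]
  refine Finset.sum_congr rfl fun b _ => ?_
  rw [Fintype.sum_unique]
  rfl

/-- Sums over rank-3 multi-indices are triple sums. -/
theorem sum_tens_three (g : (Fin 3 → Fin 3) → ℝ) :
    ∑ idx : Fin 3 → Fin 3, g idx = ∑ a : Fin 3, ∑ b : Fin 3, ∑ c : Fin 3, g ![a, b, c] := by
  rw [← (Fin.consEquiv fun _ : Fin 3 => Fin 3).sum_comp, Fintype.sum_prod_type]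
  refine Finset.sum_congr rfl fun a _ => ?_
  rw [sum_tens_two]
  rfl

/-- The traceless rank-2 test returns the `(j,k)` entry minus the trace part:
`⟨C2 j k, y ⊗ y⟩ = y_j y_k − δ_{jk} |y|²/3`. -/
theorem pairT_C2_tpow (j k : Fin 3) (y : V3) :
    pairT (C2 j k) (tpow 2 y) = y j * y k - (if j = k then (∑ l : Fin 3, y l ^ 2) / 3 else 0) := by
  unfold pairT C2 tpow
  rw [sum_tens_two]
  simp only [Fin.prod_univ_two, Matrix.cons_val_zero, Matrix.cons_val_one, sub_mul,
    Finset.sum_sub_distrib, ite_mul, one_mul, zero_mul, ite_and, Finset.sum_ite_irrel,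
    Finset.sum_const_zero, Finset.sum_ite_eq, Finset.sum_ite_eq', Finset.mem_univ, if_true]
  congr 1
  split_ifs
  · rw [Finset.sum_div]
    exact Finset.sum_congr rfl fun l _ => by ring
  · rfl

/-- The rank-3 test returns half the `a`-component times the squared norm:
`⟨C3 a, y^{⊗3}⟩ = ½ |y|² y_a`. -/
theorem pairT_C3_tpow (a : Fin 3) (y : V3) :
    pairT (C3 a) (tpow 3 y) = (∑ l : Fin 3, y l ^ 2) / 2 * y a := by
  unfold pairT C3 tpow
  rw [sum_tens_three]
  simp only [Fin.prod_univ_three, Matrix.cons_val_zero, Matrix.cons_val_one, Matrix.cons_val_two,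
    Matrix.tail_cons, Matrix.head_cons, ite_mul, zero_mul, ite_and, Finset.sum_ite_irrel,
    Finset.sum_const_zero, Finset.sum_ite_eq, Finset.sum_ite_eq', Finset.mem_univ, if_true]
  rw [Finset.sum_div, Finset.sum_mul]
  exact Finset.sum_congr rfl fun l _ => by ring

/-- Finite-sum form of the block velocity `ū = m̄/ρ̄`. -/
theorem ubar_eq (Φ : Flow σ N) (φ : ℕ → T3 → ℝ) (s : ℝ) (z : Cfg N) (x : T3) :
    ubar σ N Φ φ s z x =
      ((((N + 1 : ℕ) : ℝ))⁻¹ * ∑ i, φ N ((Φ.flow s z i).1 - x))⁻¹ •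
        ((((N + 1 : ℕ) : ℝ))⁻¹ • ∑ i, φ N ((Φ.flow s z i).1 - x) • (Φ.flow s z i).2) := by
  unfold ubar empiricalDensityField empiricalMomentumField
  rw [integral_empiricalMeasure_real, integral_empiricalMeasure_vec]

/-- DICTIONARY, stress channel: the crux's `D N s z x j k` (empirical integrals) is the flow-side
block moment `blkFlow 2 … (C2 j k)` (finite sums). -/
theorem crux_D_eq (Φ : Flow σ N) (φ : ℕ → T3 → ℝ) (s : ℝ) (z : Cfg N) (x : T3) (j k : Fin 3) :
    (∫ y, φ N (y.1 - x) * ((y.2 j - ubar σ N Φ φ s z x j) * (y.2 k - ubar σ N Φ φ s z x k))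
        ∂(empiricalMeasure (Φ.flow s z))) -
      (if j = k then (∑ l : Fin 3, ∫ y, φ N (y.1 - x) * (y.2 l - ubar σ N Φ φ s z x l) ^ 2
        ∂(empiricalMeasure (Φ.flow s z))) / 3 else 0) = blkFlow 2 σ N Φ φ s z x (C2 j k) := by
  simp only [integral_empiricalMeasure_real]
  unfold blkFlow wgt
  simp only [pairT_C2_tpow, PiLp.sub_apply, mul_sub, Finset.sum_sub_distrib, mul_ite, mul_zero,
    Finset.sum_ite_irrel, Finset.sum_const_zero]
  split_ifs
  · congr 1
    simp only [Finset.sum_div, Finset.mul_sum]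
    rw [Finset.sum_comm]
    exact Finset.sum_congr rfl fun i _ => Finset.sum_congr rfl fun l _ => by ring
  · simp

/-- DICTIONARY, heat-flux channel: the `a`-component of the crux's `q N s z x` is
`blkFlow 3 … (C3 a)`. -/
theorem crux_q_apply (Φ : Flow σ N) (φ : ℕ → T3 → ℝ) (s : ℝ) (z : Cfg N) (x : T3) (a : Fin 3) :
    (∫ y, (φ N (y.1 - x) * ‖y.2 - ubar σ N Φ φ s z x‖ ^ 2 / 2) • (y.2 - ubar σ N Φ φ s z x)
        ∂(empiricalMeasure (Φ.flow s z))) a = blkFlow 3 σ N Φ φ s z x (C3 a) := by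
  rw [integral_empiricalMeasure_vec]
  unfold blkFlow wgt
  simp only [pairT_C3_tpow, PiLp.smul_apply, WithLp.ofLp_sum, Finset.sum_apply, PiLp.sub_apply,
    smul_eq_mul, EuclideanSpace.real_norm_sq_eq]
  congr 1
  exact Finset.sum_congr rfl fun i _ => by ring

/-- DICTIONARY: `|q|² = Σ_a blkFlow 3 (C3 a)²`. -/
theorem crux_q_norm_sq (Φ : Flow σ N) (φ : ℕ → T3 → ℝ) (s : ℝ) (z : Cfg N) (x : T3) :
    ‖∫ y, (φ N (y.1 - x) * ‖y.2 - ubar σ N Φ φ s z x‖ ^ 2 / 2) • (y.2 - ubar σ N Φ φ s z x)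
        ∂(empiricalMeasure (Φ.flow s z))‖ ^ 2 = ∑ a, blkFlow 3 σ N Φ φ s z x (C3 a) ^ 2 := by
  rw [EuclideanSpace.real_norm_sq_eq]
  exact Finset.sum_congr rfl fun a _ => by rw [crux_q_apply]

/-- DICTIONARY (step (a) of `stub_reduction`): the crux's integrand `Σ_{jk} D² + |q|²` at
`(s, z, x)` IS `DefectSq σ N Φ φ s z x`, for every `s, z, x` (no almost-sure statement here). -/
theorem cruxIntegrand_eq (Φ : Flow σ N) (φ : ℕ → T3 → ℝ) (s : ℝ) (z : Cfg N) (x : T3) :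
    (∑ j, ∑ k, ((∫ y, φ N (y.1 - x) * ((y.2 j - ubar σ N Φ φ s z x j) *
        (y.2 k - ubar σ N Φ φ s z x k)) ∂(empiricalMeasure (Φ.flow s z))) -
      (if j = k then (∑ l : Fin 3, ∫ y, φ N (y.1 - x) * (y.2 l - ubar σ N Φ φ s z x l) ^ 2
        ∂(empiricalMeasure (Φ.flow s z))) / 3 else 0)) ^ 2) +
      ‖∫ y, (φ N (y.1 - x) * ‖y.2 - ubar σ N Φ φ s z x‖ ^ 2 / 2) • (y.2 - ubar σ N Φ φ s z x)
        ∂(empiricalMeasure (Φ.flow s z))‖ ^ 2 = DefectSq σ N Φ φ s z x := by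
  unfold DefectSq
  rw [crux_q_norm_sq]
  simp only [crux_D_eq]

/-! ## The fold IS the flow on the dictionary event; Duhamel paired with the weights -/

/-- The line window is nonnegative (registered anchor of this helper file). -/
theorem reduction_winLen_nonneg : ∀ (N : ℕ) (s : ℝ), 0 ≤ winLen N s := by
  intro N s
  unfold winLen Δℓ
  split_ifs
  · exact le_rfl
  · exact mul_nonneg (Real.rpow_nonneg (by positivity) _) (Real.log_nonneg (by linarith))

/-- DICTIONARY (step (b) of `stub_reduction`): on the dictionary event the flow-side block moment
at `(s, x)` is the fold-side block moment of the fold restarted at the window start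
`Φ_{s − winLen} z`, with `steps (winLen N s)` steps, weights `wgt` and shift `ubar`. -/
theorem blkFlow_eq_blkF {Φ : Flow σ N} {z : Cfg N}
    (hz : ∀ s Δ : ℝ, 0 ≤ Δ →
      (fun i => (Φ.flow (s + Δ) z i).2) = velAfter σ N (Φ.flow s z) (steps σ N (Φ.flow s z) Δ))
    (φ : ℕ → T3 → ℝ) (r : ℕ) (s : ℝ) (x : T3) (C : Tens r) :
    blkFlow r σ N Φ φ s z x C = blkF r σ N (winStart σ N Φ s z)
      (steps σ N (winStart σ N Φ s z) (winLen N s)) (wgt σ N Φ φ s z x) (ubar σ N Φ φ s z x) C := by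
  have h := hz (s - winLen N s) (winLen N s) (reduction_winLen_nonneg N s)
  rw [sub_add_cancel] at h
  unfold blkFlow blkF winStart
  congr 1
  refine Finset.sum_congr rfl fun i _ => ?_
  rw [show (Φ.flow s z i).2 = velAfter σ N (Φ.flow (s - winLen N s) z)
    (steps σ N (Φ.flow (s - winLen N s) z) (winLen N s)) i from congrFun h i]

/-- The pairing is additive in the tensor. -/
theorem pairT_add {r : ℕ} (C A B : Tens r) : pairT C (A + B) = pairT C A + pairT C B := by
  simp only [pairT, Pi.add_apply, mul_add, Finset.sum_add_distrib]

/-- The pairing commutes with finite sums of tensors. -/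
theorem pairT_sum {r : ℕ} {ι : Type*} (C : Tens r) (S : Finset ι) (F : ι → Tens r) :
    pairT C (∑ l ∈ S, F l) = ∑ l ∈ S, pairT C (F l) := by
  simp only [pairT, Finset.sum_apply, Finset.mul_sum]
  rw [Finset.sum_comm]

/-- VARIATION OF CONSTANTS PAIRED WITH THE WEIGHTS: `blkF = pastF + xiF`, test by test
(`DuhamelIdentity σ` evaluated at each particle, paired with `C`, weighted and averaged). -/
theorem blkF_eq_pastF_add_xiF (hDu : DuhamelIdentity σ) {r : ℕ} (hr : 0 < r) (y : Cfg N) (m : ℕ)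
    (w : Fin (N + 1) → ℝ) (u : V3) (C : Tens r) :
    blkF r σ N y m w u C = pastF r σ N y m w u C + xiF r σ N y m w u C := by
  have h := hDu r N y u m hr
  unfold blkF pastF xiF
  rw [Finset.sum_comm, ← mul_add, ← Finset.sum_add_distrib]
  congr 1
  refine Finset.sum_congr rfl fun i _ => ?_
  rw [show tpow r (velAfter σ N y m i - u) = _ from congrFun h i, Pi.add_apply, Finset.sum_apply,
    pairT_add, pairT_sum, mul_add, Finset.mul_sum]

/-! ## Pointwise Peter–Paul (step (c) of `stub_reduction`) -/

/-- `B = P + X` implies `B² ≤ 2ηB² + (4η)⁻¹(P² + (X − Xc)²) + B·Xc` for every `η > 0`. -/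
theorem sq_le_peterPaul {B P X Xc η : ℝ} (hη : 0 < η) (hB : B = P + X) :
    B ^ 2 ≤ 2 * η * B ^ 2 + (4 * η)⁻¹ * (P ^ 2 + (X - Xc) ^ 2) + B * Xc := by
  have h4 : 0 < 4 * η := by positivity
  have key : 4 * η * B ^ 2 ≤ 4 * η * (2 * η * B ^ 2 + B * Xc) + (P ^ 2 + (X - Xc) ^ 2) := by
    subst hB
    nlinarith [sq_nonneg (2 * η * (P + X) - P), sq_nonneg (2 * η * (P + X) - (X - Xc))]
  have key' : B ^ 2 ≤ (2 * η * B ^ 2 + B * Xc) + (4 * η)⁻¹ * (P ^ 2 + (X - Xc) ^ 2) := by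
    rw [← sub_nonneg] at key ⊢
    have : (2 * η * B ^ 2 + B * Xc) + (4 * η)⁻¹ * (P ^ 2 + (X - Xc) ^ 2) - B ^ 2 =
        (4 * η)⁻¹ * (4 * η * (2 * η * B ^ 2 + B * Xc) + (P ^ 2 + (X - Xc) ^ 2) - 4 * η * B ^ 2) := by
      field_simp
    rw [this]
    exact mul_nonneg (inv_nonneg.2 h4.le) key
  linarith

/-- Summed Peter–Paul over a finite family of tests. -/
theorem sum_sq_le_peterPaul {ι : Type*} (S : Finset ι) {η : ℝ} (hη : 0 < η) (B P X Xc : ι → ℝ)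
    (hB : ∀ i ∈ S, B i = P i + X i) :
    ∑ i ∈ S, B i ^ 2 ≤ 2 * η * ∑ i ∈ S, B i ^ 2 +
      (4 * η)⁻¹ * (∑ i ∈ S, P i ^ 2 + ∑ i ∈ S, (X i - Xc i) ^ 2) + ∑ i ∈ S, B i * Xc i := by
  have h := Finset.sum_le_sum fun i hi => sq_le_peterPaul (Xc := Xc i) hη (hB i hi)
  refine h.trans_eq ?_
  simp only [Finset.sum_add_distrib, ← Finset.mul_sum]

/-- POINTWISE REDUCTION INEQUALITY (steps (b)–(c) of `stub_reduction`): on the dictionary event,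
for every `η > 0`, `s` and `x`,
`DefectSq ≤ 2η DefectSq + (4η)⁻¹ (PastSq + XiDevSq) + XiCorr`. -/
theorem defectSq_le (hDu : DuhamelIdentity σ) {Φ : Flow σ N} {z : Cfg N}
    (hz : ∀ s Δ : ℝ, 0 ≤ Δ →
      (fun i => (Φ.flow (s + Δ) z i).2) = velAfter σ N (Φ.flow s z) (steps σ N (Φ.flow s z) Δ))
    (φ : ℕ → T3 → ℝ) {η : ℝ} (hη : 0 < η) (s : ℝ) (x : T3) :
    DefectSq σ N Φ φ s z x ≤ 2 * η * DefectSq σ N Φ φ s z x +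
      (4 * η)⁻¹ * (PastSq σ N Φ φ s z x + XiDevSq σ N Φ φ s z x) + XiCorr σ N Φ φ s z x := by
  have hB : ∀ (r : ℕ), 0 < r → ∀ C : Tens r, blkFlow r σ N Φ φ s z x C =
      pastF r σ N (winStart σ N Φ s z) (steps σ N (winStart σ N Φ s z) (winLen N s))
        (wgt σ N Φ φ s z x) (ubar σ N Φ φ s z x) C +
      xiF r σ N (winStart σ N Φ s z) (steps σ N (winStart σ N Φ s z) (winLen N s))
        (wgt σ N Φ φ s z x) (ubar σ N Φ φ s z x) C := fun r hr C => by
    rw [blkFlow_eq_blkF hz φ r s x C, blkF_eq_pastF_add_xiF hDu hr]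
  have h2 := Finset.sum_le_sum fun j (_ : j ∈ (Finset.univ : Finset (Fin 3))) =>
    sum_sq_le_peterPaul Finset.univ hη (fun k => blkFlow 2 σ N Φ φ s z x (C2 j k))
      (fun k => pastF 2 σ N (winStart σ N Φ s z) (steps σ N (winStart σ N Φ s z) (winLen N s))
        (wgt σ N Φ φ s z x) (ubar σ N Φ φ s z x) (C2 j k))
      (fun k => xiF 2 σ N (winStart σ N Φ s z) (steps σ N (winStart σ N Φ s z) (winLen N s))
        (wgt σ N Φ φ s z x) (ubar σ N Φ φ s z x) (C2 j k))
      (fun k => xiChF 2 σ N (winStart σ N Φ s z) (steps σ N (winStart σ N Φ s z) (winLen N s))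
        (wgt σ N Φ φ s z x) (ubar σ N Φ φ s z x) (C2 j k))
      (fun k _ => hB 2 two_pos (C2 j k))
  have h3 := sum_sq_le_peterPaul Finset.univ hη (fun a => blkFlow 3 σ N Φ φ s z x (C3 a))
      (fun a => pastF 3 σ N (winStart σ N Φ s z) (steps σ N (winStart σ N Φ s z) (winLen N s))
        (wgt σ N Φ φ s z x) (ubar σ N Φ φ s z x) (C3 a))
      (fun a => xiF 3 σ N (winStart σ N Φ s z) (steps σ N (winStart σ N Φ s z) (winLen N s))
        (wgt σ N Φ φ s z x) (ubar σ N Φ φ s z x) (C3 a))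
      (fun a => xiChF 3 σ N (winStart σ N Φ s z) (steps σ N (winStart σ N Φ s z) (winLen N s))
        (wgt σ N Φ φ s z x) (ubar σ N Φ φ s z x) (C3 a))
      (fun a _ => hB 3 three_pos (C3 a))
  simp only [Finset.sum_add_distrib, ← Finset.mul_sum] at h2
  unfold DefectSq PastSq XiDevSq XiCorr
  linarith [h2, h3]

end

end Summit.AtomisticToContinuum.HydrodynamicLimit.Theorems.ContactSourceDuhamel.TimeLocal.Reduction
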